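import Mathlib
import Summits.NavierStokesRegularity.NavierStokesRegularity.Theorems.ScenarioCensusPeriodicSlabStream
import HarnessLib

/-!
# Census row S7 (c): the bounded corrector potential `Φ̃ = f − f(√(1 + r²) e₀)`

Support file for the scenario census of `NavierStokesRegularity` (cell `pub/ns-census`, block S,
row S7 = Bang–Gui–Wang–Xie, J. Fluid Mech. 1005 (2025) A6 = arXiv:2205.13259, Thm 1.4 (c)).
The stream potential `f = streamPotential g` of `…PeriodicSlabStream` grows linearly; subtracting
its value at the smooth radial reference point `√(1 + r²) e₀` gives a `C¹` potential `Φ̃` with the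
SAME angular derivative (the radial flux `⟪x_h, g(x_h)⟫`), gradient `‖DΦ̃‖ ≤ 2 sup ‖g‖`, and size
`|Φ̃(x)| ≤ π N + sup ‖g‖` on every circle where the radial flux is bounded by `N`
(`abs_streamCorrector_le`). In the proof of Thm 1.4 (c) this replaces the `H¹₀` bound (4-15) of
the printed Bogovskiĭ corrector: the tree's corrector is `Ψ = Φ̃ J∇φ` (sequel
`…PeriodicSlabCorrector`).

No summit statement and no census row is proved in this file.

## References

* J. Bang, C. Gui, Y. Wang, C. Xie, arXiv:2205.13259, §5 Step 3 (proof of Thm 1.4 (c)).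
  [BangGuiWangXie2025]
-/

-- the summit and its single problem share the name (D-0017 nested layout)
set_option linter.dupNamespace false

noncomputable section

open MeasureTheory Set Function Filter InnerProductSpace
open scoped Topology RealInnerProductSpace Interval

namespace Summit.NavierStokesRegularity.NavierStokesRegularity.Theorems.ScenarioCensus.PeriodicSlab

open Literature.Analysis Literature.Analysis.FluidPDE
/-! ### The corrector potential `Φ̃ = f − f(√(1 + r²) e₀)` -/

/-- The smooth radial reference radius `s(x) = √(1 + r(x)²)` (≥ 1, smooth everywhere). -/
def refRadius (x : EuclideanSpace ℝ (Fin 3)) : ℝ := Real.sqrt (1 + ‖horizPart x‖ ^ 2)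

/-- `s(x) = √(1 + r²)` is positive. -/
theorem refRadius_pos (x : EuclideanSpace ℝ (Fin 3)) : 0 < refRadius x :=
  Real.sqrt_pos.2 (by positivity)

/-- `r ≤ s(x) ≤ r + 1`. -/
theorem cylRadius_le_refRadius (x : EuclideanSpace ℝ (Fin 3)) :
    cylRadius x ≤ refRadius x ∧ refRadius x ≤ cylRadius x + 1 := by
  rw [refRadius, norm_horizPart]
  have h0 := cylRadius_nonneg x
  constructor
  · calc cylRadius x = Real.sqrt (cylRadius x ^ 2) := (Real.sqrt_sq h0).symm
      _ ≤ Real.sqrt (1 + cylRadius x ^ 2) := Real.sqrt_le_sqrt (by linarith)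
  · rw [Real.sqrt_le_left (by linarith)]
    nlinarith

/-- The derivative of `s(x) = √(1 + ‖x_h‖²)`: `Ds(x) v = ⟪x_h, v⟫ / s(x)`. -/
theorem hasFDerivAt_refRadius (x : EuclideanSpace ℝ (Fin 3)) :
    HasFDerivAt refRadius ((refRadius x)⁻¹ • innerSL ℝ (horizPart x)) x := by
  have h1 : HasFDerivAt (fun y : EuclideanSpace ℝ (Fin 3) => 1 + ‖horizPart y‖ ^ 2)
      (2 • (innerSL ℝ (horizPart x)).comp horizPart) x := by
    have h := ((hasFDerivAt_id (horizPart x)).norm_sq).comp x horizPart.hasFDerivAt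
    have h' : HasFDerivAt (fun y : EuclideanSpace ℝ (Fin 3) => ‖horizPart y‖ ^ 2)
        (2 • (innerSL ℝ (horizPart x)).comp horizPart) x := by
      refine h.congr_fderiv ?_
      ext v
      simp [ContinuousLinearMap.comp_apply, innerSL_apply_apply]
    simpa using h'.const_add 1
  have hpos : 1 + ‖horizPart x‖ ^ 2 ≠ 0 := by positivity
  have h2 := h1.sqrt hpos
  refine h2.congr_fderiv ?_
  ext v
  simp only [refRadius, _root_.smul_apply, ContinuousLinearMap.comp_apply,
    innerSL_apply_apply, inner_horizPart_horizPart, smul_eq_mul]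
  field_simp
  ring

/-- **The corrector potential** `Φ̃(x) = f(x) − f(s(x) e₀)`, `f = streamPotential g`,
`s(x) = √(1 + r²)`: the stream potential minus its value at a smooth radial reference point. -/
def streamCorrector (g : EuclideanSpace ℝ (Fin 3) → EuclideanSpace ℝ (Fin 3))
    (x : EuclideanSpace ℝ (Fin 3)) : ℝ :=
  streamPotential g x - streamPotential g (refRadius x • EuclideanSpace.single 0 1)

/-- **Derivative of the corrector potential**:
`DΦ̃(x) v = ⟪J g(x_h), v⟫ − ⟪J g(s e₀), e₀⟫ ⟪x_h, v⟫ / s`. -/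
theorem hasFDerivAt_streamCorrector {g : EuclideanSpace ℝ (Fin 3) → EuclideanSpace ℝ (Fin 3)}
    {Dg : EuclideanSpace ℝ (Fin 3) → (EuclideanSpace ℝ (Fin 3) →L[ℝ] EuclideanSpace ℝ (Fin 3))}
    (hg : ∀ y, HasFDerivAt g (Dg y) y) (hDgc : Continuous Dg) {G₀ K : ℝ}
    (hG₀ : ∀ y, ‖g y‖ ≤ G₀) (hK : ∀ y, ‖Dg y‖ ≤ K)
    (htr : ∀ y, Dg y (EuclideanSpace.single 0 1) 0 + Dg y (EuclideanSpace.single 1 1) 1 = 0)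
    (x : EuclideanSpace ℝ (Fin 3)) :
    HasFDerivAt (streamCorrector g)
      (innerSL ℝ (rotGen (g (horizPart x))) -
        (⟪rotGen (g (horizPart (refRadius x • EuclideanSpace.single 0 (1 : ℝ)))),
            (EuclideanSpace.single 0 (1 : ℝ) : EuclideanSpace ℝ (Fin 3))⟫ * (refRadius x)⁻¹) •
          innerSL ℝ (horizPart x)) x := by
  set e₀ : EuclideanSpace ℝ (Fin 3) := EuclideanSpace.single 0 1 with he₀
  have hf := hasFDerivAt_streamPotential hg hDgc hG₀ hK htr
  have h1 := (hasFDerivAt_refRadius x).smul_const e₀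
  have h2 := (hf (refRadius x • e₀)).comp x h1
  refine ((hf x).sub h2).congr_fderiv ?_
  ext v
  simp only [_root_.sub_apply, ContinuousLinearMap.comp_apply,
    ContinuousLinearMap.smulRight_apply, _root_.smul_apply, innerSL_apply_apply,
    smul_eq_mul, real_inner_smul_right]
  ring

/-- **Properties of the corrector potential.** Under the hypotheses of
`hasFDerivAt_streamPotential` (`‖g‖ ≤ G₀`): `Φ̃ = streamCorrector g` is differentiable,
`‖DΦ̃(x)‖ ≤ 2 G₀`, its angular derivative is the radial flux `DΦ̃(x)[J x] = ⟪x_h, g(x_h)⟫`, and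
its derivative is continuous. -/
theorem streamCorrector_deriv {g : EuclideanSpace ℝ (Fin 3) → EuclideanSpace ℝ (Fin 3)}
    {Dg : EuclideanSpace ℝ (Fin 3) → (EuclideanSpace ℝ (Fin 3) →L[ℝ] EuclideanSpace ℝ (Fin 3))}
    (hg : ∀ y, HasFDerivAt g (Dg y) y) (hDgc : Continuous Dg) {G₀ K : ℝ}
    (hG₀ : ∀ y, ‖g y‖ ≤ G₀) (hK : ∀ y, ‖Dg y‖ ≤ K)
    (htr : ∀ y, Dg y (EuclideanSpace.single 0 1) 0 + Dg y (EuclideanSpace.single 1 1) 1 = 0) :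
    Differentiable ℝ (streamCorrector g) ∧ Continuous (fderiv ℝ (streamCorrector g)) ∧
      (∀ x, ‖fderiv ℝ (streamCorrector g) x‖ ≤ 2 * G₀) ∧
      ∀ x, fderiv ℝ (streamCorrector g) x (rotGen x) = ⟪horizPart x, g (horizPart x)⟫ := by
  have nrot : ∀ w : EuclideanSpace ℝ (Fin 3), ‖rotGen w‖ ≤ ‖w‖ := fun w => by
    have h1 : ‖rotGen w‖ ^ 2 ≤ ‖w‖ ^ 2 := by
      rw [EuclideanSpace.real_norm_sq_eq, EuclideanSpace.real_norm_sq_eq]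
      simp only [Fin.sum_univ_three, rotGen_apply_zero, rotGen_apply_one, rotGen_apply_two]
      nlinarith [sq_nonneg (w 2)]
    exact (pow_le_pow_iff_left₀ (norm_nonneg _) (norm_nonneg _) two_ne_zero).1 h1
  set e₀ : EuclideanSpace ℝ (Fin 3) := EuclideanSpace.single 0 1 with he₀
  have hgc : Continuous g := continuous_iff_continuousAt.2 fun y => (hg y).continuousAt
  have hG₀0 : 0 ≤ G₀ := (norm_nonneg _).trans (hG₀ 0)
  have hD := hasFDerivAt_streamCorrector hg hDgc hG₀ hK htr
  have hfd : ∀ x, fderiv ℝ (streamCorrector g) x = innerSL ℝ (rotGen (g (horizPart x))) -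
      (⟪rotGen (g (horizPart (refRadius x • e₀))), e₀⟫ * (refRadius x)⁻¹) • innerSL ℝ (horizPart x) :=
    fun x => (hD x).fderiv
  have he₀n : ‖e₀‖ = 1 := by simp [he₀]
  refine ⟨fun x => (hD x).differentiableAt, ?_, fun x => ?_, fun x => ?_⟩
  · -- continuity of the derivative
    have hc : Continuous fun x => innerSL ℝ (rotGen (g (horizPart x))) -
        (⟪rotGen (g (horizPart (refRadius x • e₀))), e₀⟫ * (refRadius x)⁻¹) • innerSL ℝ (horizPart x) := by
      have hs : Continuous refRadius := continuous_iff_continuousAt.2 fun y =>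
        (hasFDerivAt_refRadius y).continuousAt
      refine ((innerSL ℝ).continuous.comp (rotGenL.continuous.comp (hgc.comp horizPart.continuous))).sub ?_
      have hsc : Continuous fun x => ⟪rotGen (g (horizPart (refRadius x • e₀))), e₀⟫ * (refRadius x)⁻¹ := by
        refine Continuous.mul ?_ (hs.inv₀ fun y => (refRadius_pos y).ne')
        exact ((rotGenL.continuous.comp (hgc.comp (horizPart.continuous.comp
          (hs.smul continuous_const)))).inner continuous_const)
      exact hsc.smul ((innerSL ℝ).continuous.comp horizPart.continuous)
    exact hc.congr fun x => (hfd x).symm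
  · -- the bound `‖DΦ̃‖ ≤ 2 G₀`
    rw [hfd x]
    have hs0 := refRadius_pos x
    have h1 : ‖innerSL ℝ (rotGen (g (horizPart x)))‖ ≤ G₀ := by
      rw [innerSL_apply_norm]; exact (nrot _).trans (hG₀ _)
    have h2 : ‖(⟪rotGen (g (horizPart (refRadius x • e₀))), e₀⟫ * (refRadius x)⁻¹) •
        innerSL ℝ (horizPart x)‖ ≤ G₀ := by
      rw [norm_smul, innerSL_apply_norm, norm_mul, Real.norm_eq_abs, Real.norm_eq_abs,
        abs_inv, abs_of_pos hs0, norm_horizPart]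
      have h3 : |⟪rotGen (g (horizPart (refRadius x • e₀))), e₀⟫| ≤ G₀ := by
        calc |⟪rotGen (g (horizPart (refRadius x • e₀))), e₀⟫|
            ≤ ‖rotGen (g (horizPart (refRadius x • e₀)))‖ * ‖e₀‖ := abs_real_inner_le_norm _ _
          _ ≤ G₀ := by rw [he₀n, mul_one]; exact (nrot _).trans (hG₀ _)
      have h4 : (refRadius x)⁻¹ * cylRadius x ≤ 1 := by
        rw [inv_mul_le_iff₀ hs0, mul_one]; exact (cylRadius_le_refRadius x).1
      calc |⟪rotGen (g (horizPart (refRadius x • e₀))), e₀⟫| * (refRadius x)⁻¹ * cylRadius x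
          = |⟪rotGen (g (horizPart (refRadius x • e₀))), e₀⟫| * ((refRadius x)⁻¹ * cylRadius x) := by ring
        _ ≤ G₀ * 1 := mul_le_mul h3 h4 (mul_nonneg (inv_nonneg.2 hs0.le) (cylRadius_nonneg x)) hG₀0
        _ = G₀ := mul_one _
    exact (norm_sub_le _ _).trans (by linarith)
  · -- the angular derivative
    rw [hfd x]
    simp only [_root_.sub_apply, _root_.smul_apply, innerSL_apply_apply,
      smul_eq_mul]
    rw [inner_rotGen_rotGen, ← rotGen_horizPart x, ← real_inner_comm (horizPart x) (rotGen (horizPart x)),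
      inner_rotGen_self, mul_zero, sub_zero]

/-- **Size of the corrector potential on circles.** Under the hypotheses of
`hasFDerivAt_streamPotential`: if `r(x) > 0` and `|⟪y_h, g y⟫| ≤ N` at the horizontal points of
the circle of radius `r(x)`, then `|Φ̃(x)| ≤ π N + G₀`. -/
theorem abs_streamCorrector_le {g : EuclideanSpace ℝ (Fin 3) → EuclideanSpace ℝ (Fin 3)}
    {Dg : EuclideanSpace ℝ (Fin 3) → (EuclideanSpace ℝ (Fin 3) →L[ℝ] EuclideanSpace ℝ (Fin 3))}
    (hg : ∀ y, HasFDerivAt g (Dg y) y) (hDgc : Continuous Dg) {G₀ K : ℝ}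
    (hG₀ : ∀ y, ‖g y‖ ≤ G₀) (hK : ∀ y, ‖Dg y‖ ≤ K)
    (htr : ∀ y, Dg y (EuclideanSpace.single 0 1) 0 + Dg y (EuclideanSpace.single 1 1) 1 = 0)
    {x : EuclideanSpace ℝ (Fin 3)} (hx : 0 < cylRadius x) {N : ℝ}
    (hN : ∀ y : EuclideanSpace ℝ (Fin 3), horizPart y = y → cylRadius y = cylRadius x →
      |⟪horizPart y, g y⟫| ≤ N) :
    |streamCorrector g x| ≤ Real.pi * N + G₀ := by
  have nrot : ∀ w : EuclideanSpace ℝ (Fin 3), ‖rotGen w‖ ≤ ‖w‖ := fun w => by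
    have h1 : ‖rotGen w‖ ^ 2 ≤ ‖w‖ ^ 2 := by
      rw [EuclideanSpace.real_norm_sq_eq, EuclideanSpace.real_norm_sq_eq]
      simp only [Fin.sum_univ_three, rotGen_apply_zero, rotGen_apply_one, rotGen_apply_two]
      nlinarith [sq_nonneg (w 2)]
    exact (pow_le_pow_iff_left₀ (norm_nonneg _) (norm_nonneg _) two_ne_zero).1 h1
  set e₀ : EuclideanSpace ℝ (Fin 3) := EuclideanSpace.single 0 1 with he₀
  set f := streamPotential g with hf
  have hG₀0 : 0 ≤ G₀ := (norm_nonneg _).trans (hG₀ 0)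
  have h1 : |f x - f (cylRadius x • e₀)| ≤ Real.pi * N :=
    abs_streamPotential_sub_le_of_circle hg hDgc hG₀ hK htr hx hN
  -- along the ray from `r e₀` to `s e₀`
  have hfd : ∀ y, HasFDerivAt f (innerSL ℝ (rotGen (g (horizPart y)))) y :=
    hasFDerivAt_streamPotential hg hDgc hG₀ hK htr
  set q : ℝ → ℝ := fun τ => f (τ • e₀) with hq
  have hqd : ∀ τ, HasDerivAt q ⟪rotGen (g (horizPart (τ • e₀))), e₀⟫ τ := by
    intro τ
    have hl : HasDerivAt (fun σ : ℝ => σ • e₀) e₀ τ := by simpa using (hasDerivAt_id τ).smul_const e₀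
    have h := (hfd (τ • e₀)).comp_hasDerivAt τ hl
    rw [innerSL_apply_apply] at h
    exact h
  have he₀n : ‖e₀‖ = 1 := by simp [he₀]
  have hqb : ∀ τ, ‖deriv q τ‖ ≤ G₀ := fun τ => by
    rw [(hqd τ).deriv, Real.norm_eq_abs]
    calc |⟪rotGen (g (horizPart (τ • e₀))), e₀⟫| ≤ ‖rotGen (g (horizPart (τ • e₀)))‖ * ‖e₀‖ :=
          abs_real_inner_le_norm _ _
      _ ≤ G₀ := by rw [he₀n, mul_one]; exact (nrot _).trans (hG₀ _)
  have h2 : ‖q (refRadius x) - q (cylRadius x)‖ ≤ G₀ * ‖refRadius x - cylRadius x‖ :=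
    (convex_univ).norm_image_sub_le_of_norm_deriv_le (fun τ _ => (hqd τ).differentiableAt)
      (fun τ _ => hqb τ) (mem_univ _) (mem_univ _)
  have h3 : ‖refRadius x - cylRadius x‖ ≤ 1 := by
    have h := cylRadius_le_refRadius x
    rw [Real.norm_eq_abs, abs_of_nonneg (by linarith [h.1])]; linarith [h.2]
  have h4 : |q (refRadius x) - q (cylRadius x)| ≤ G₀ := by
    rw [← Real.norm_eq_abs]
    exact h2.trans ((mul_le_mul_of_nonneg_left h3 hG₀0).trans (by rw [mul_one]))
  have e : streamCorrector g x = (f x - f (cylRadius x • e₀)) - (q (refRadius x) - q (cylRadius x)) := by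
    simp only [streamCorrector, hq, hf, he₀]; ring
  rw [e]
  calc |(f x - f (cylRadius x • e₀)) - (q (refRadius x) - q (cylRadius x))|
      ≤ |f x - f (cylRadius x • e₀)| + |q (refRadius x) - q (cylRadius x)| := abs_sub _ _
    _ ≤ Real.pi * N + G₀ := add_le_add h1 h4

end Summit.NavierStokesRegularity.NavierStokesRegularity.Theorems.ScenarioCensus.PeriodicSlab

end
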